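import Summits.FinalStateConjecture.FinalStateConjecture.Theses.ZeroEnergyKerrOrBomb
import Literature.Geometry.Lorentzian.CausalityOpennessProofs

/-!
# `NonTrappingHawkingRigidity` (crux `stmt-FinalStateConjecture-13896`): the collar field's scale and
# time-orientation are not load-bearing

Negative-lane load-bearing analysis (cdisprove seat, cycle 1).  The crux hands the prover a
Killing–timelike collar `(U, K)`: `U` open `⊇ 𝓔⁺`, `K` smooth on `U` (h9), Killing on `U` (h10),
`[T, K] = 0` on `U` (h11), `K ≠ 0` on `𝓔⁺` (h12), whole-line integral curves of `K` from `𝓔⁺` stay in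
`𝓔⁺` (h13), `K` timelike on `U ∩ doc` (h14), and asks for a `T`-commuting Killing extension `K'` over
the d.o.c. docking with `K` near `𝓔⁺`.

**All six collar clauses and the conclusion are invariant under `K ↦ c • K`, `c ≠ 0`**
(`collar_const_smul`, `collar_const_smul_iff`, `conclusion_const_smul_iff`): h9–h11 and the
conclusion are linear (`∇(c • K) = c • ∇K`, `[T, c • K] = c • [T, K]` at smooth points), h12 is
homogeneous, h13 sees the reparametrised integral curves (`IsMIntegralCurve.comp_mul`), h14 is
quadratic.  Consequently the telescope fixes NEITHER the time-orientation of `K` (future/past directed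
on `U ∩ doc`; take `c = −1`) NOR its scale (the surface gravity `κ` of `K`, or "`K = T + Ω_H Φ`" as an
identity with numbers): a stub speaking of the sign of `κ`, of `K` future-directed, or of the NUMBER
`Ω_H`, must first normalise `K` — the hypotheses do not (compare the sister crux's
`HorizonKillingScaling` p75584 / `StationaryFieldRescaling` p75827 for `T`).

References: B. O'Neill, *Semi-Riemannian geometry*, Academic Press 1983, Ch. 9, Prop. 9.25 (Killing
fields form a real vector space); P. T. Chruściel, J. L. Costa, Astérisque 321 (2008), §2.3, (2.8)
(`κ` scales with the normalisation of the horizon Killing field).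
-/

-- D-0017: single-problem summit, `Summit.<S>.<S>.…` by design (cf. lakefile `weak.linter.dupNamespace`).
set_option linter.dupNamespace false

namespace Summit.FinalStateConjecture.FinalStateConjecture.Theorems.NonTrappingHawkingRigidity.Negative

open Literature.Geometry.Lorentzian
open scoped Manifold ContDiff

universe u

variable (𝓑 : StationaryAFBlackHole.{u})

/-- The d.o.c. of any presentation is open (`I^±` are open on the boundaryless carrier: the proved
facts `isOpen_chronologicalFuture/Past_holds_of_boundaryless`). O'Neill 1983, Ch. 14, Lemma 14.3.
[cite: ONeill1983, Ch. 14, Lemma 14.3] -/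
theorem isOpen_doc_of_boundaryless : IsOpen 𝓑.doc :=
  𝓑.isOpen_doc LorentzianMetric.isOpen_chronologicalFuture_holds_of_boundaryless
    LorentzianMetric.isOpen_chronologicalPast_holds_of_boundaryless

variable {𝓑}

/-- A section of `TM` smooth on an open set is differentiable at its points. [folklore] -/
theorem mdifferentiableAt_section_of_contMDiffOn {V : Set 𝓑.carrier} (hV : IsOpen V)
    {K : Π x : 𝓑.carrier, TangentSpace (𝓡 4) x}
    (h : ContMDiffOn (𝓡 4) ((𝓡 4).prod 𝓘(ℝ, E4)) ((⊤ : ℕ∞) : WithTop ℕ∞)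
      (fun x ↦ (Bundle.TotalSpace.mk' E4 x (K x) : TangentBundle (𝓡 4) 𝓑.carrier)) V)
    {x : 𝓑.carrier} (hx : x ∈ V) :
    MDifferentiableAt (𝓡 4) (𝓡 4).tangent
      (fun y ↦ (⟨y, K y⟩ : TangentBundle (𝓡 4) 𝓑.carrier)) x :=
  ((h x hx).contMDiffAt (hV.mem_nhds hx)).mdifferentiableAt (by simp)

/-- **The Killing equation on an open set passes to constant multiples** of a section smooth there:
`∇(c • K) = c • ∇K` (`IsCovariantDerivativeOn.smul_const`) and linearity. O'Neill 1983, Ch. 9,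
Prop. 9.25. [cite: ONeill1983, Ch. 9, Prop. 9.25] -/
theorem killingOn_const_smul [𝓑.metric.HasLeviCivita] {V : Set 𝓑.carrier} (hV : IsOpen V)
    {K : Π x : 𝓑.carrier, TangentSpace (𝓡 4) x}
    (hsm : ContMDiffOn (𝓡 4) ((𝓡 4).prod 𝓘(ℝ, E4)) ((⊤ : ℕ∞) : WithTop ℕ∞)
      (fun x ↦ (Bundle.TotalSpace.mk' E4 x (K x) : TangentBundle (𝓡 4) 𝓑.carrier)) V)
    (hkil : ∀ x ∈ V, ∀ v w : TangentSpace (𝓡 4) x,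
      𝓑.metric.val x (𝓑.metric.leviCivita K x v) w +
        𝓑.metric.val x v (𝓑.metric.leviCivita K x w) = 0)
    (c : ℝ) :
    ∀ x ∈ V, ∀ v w : TangentSpace (𝓡 4) x,
      𝓑.metric.val x (𝓑.metric.leviCivita (c • K) x v) w +
        𝓑.metric.val x v (𝓑.metric.leviCivita (c • K) x w) = 0 := by
  intro x hx v w
  have hs : 𝓑.metric.leviCivita (c • K) x = c • 𝓑.metric.leviCivita K x :=
    𝓑.metric.leviCivita.isCovariantDerivativeOnUniv.smul_const c
      (mdifferentiableAt_section_of_contMDiffOn hV hsm hx)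
  have h' := hkil x hx v w
  simp only [hs, FunLike.coe_smul, Pi.smul_apply, map_smul, smul_eq_mul]
  linear_combination c * h'

/-- **`[T, c • K] = 0` wherever `[T, K] = 0`**, on an open set where `K` is smooth
(`mlieBracket_const_smul_right`). [folklore] -/
theorem bracketOn_const_smul {V : Set 𝓑.carrier} (hV : IsOpen V)
    {K : Π x : 𝓑.carrier, TangentSpace (𝓡 4) x}
    (hsm : ContMDiffOn (𝓡 4) ((𝓡 4).prod 𝓘(ℝ, E4)) ((⊤ : ℕ∞) : WithTop ℕ∞)
      (fun x ↦ (Bundle.TotalSpace.mk' E4 x (K x) : TangentBundle (𝓡 4) 𝓑.carrier)) V)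
    (hbr : ∀ x ∈ V, VectorField.mlieBracket (𝓡 4) 𝓑.killing K x = 0) (c : ℝ) :
    ∀ x ∈ V, VectorField.mlieBracket (𝓡 4) 𝓑.killing (c • K) x = 0 := by
  intro x hx
  rw [VectorField.mlieBracket_const_smul_right (mdifferentiableAt_section_of_contMDiffOn hV hsm hx),
    hbr x hx, smul_zero]

/-- **Tangency via whole-line integral curves passes to `c • K`, `c ≠ 0`** (integral curves of
`c • K` are the reparametrised integral curves `γ ∘ (· * c)` of `K`, `IsMIntegralCurve.comp_mul`).
[folklore] -/
theorem integralCurves_stay_const_smul {K : Π x : 𝓑.carrier, TangentSpace (𝓡 4) x}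
    (h : ∀ γ : ℝ → 𝓑.carrier, IsMIntegralCurve γ K → γ 0 ∈ 𝓑.horizon → ∀ t, γ t ∈ 𝓑.horizon)
    {c : ℝ} (hc : c ≠ 0) :
    ∀ γ : ℝ → 𝓑.carrier, IsMIntegralCurve γ (c • K) → γ 0 ∈ 𝓑.horizon → ∀ t, γ t ∈ 𝓑.horizon := by
  intro γ hγ h0 t
  have hγ' : IsMIntegralCurve (γ ∘ (· * c⁻¹)) K := by
    simpa [smul_smul, inv_mul_cancel₀ hc] using hγ.comp_mul c⁻¹
  have h' := h _ hγ' (by simpa using h0) (t * c)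
  simpa [mul_assoc, mul_inv_cancel₀ hc] using h'

/-- **h9–h14 for `K` imply h9–h14 for `c • K`, `c ≠ 0`** (given `U` open, h6). [folklore] -/
theorem collar_const_smul [𝓑.metric.HasLeviCivita] {U : Set 𝓑.carrier} (h6 : IsOpen U)
    {K : Π x : 𝓑.carrier, TangentSpace (𝓡 4) x} {c : ℝ} (hc : c ≠ 0)
    (h9 : ContMDiffOn (𝓡 4) ((𝓡 4).prod 𝓘(ℝ, E4)) ((⊤ : ℕ∞) : WithTop ℕ∞)
      (fun x ↦ (Bundle.TotalSpace.mk' E4 x (K x) : TangentBundle (𝓡 4) 𝓑.carrier)) U)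
    (h10 : ∀ x ∈ U, ∀ v w : TangentSpace (𝓡 4) x,
      𝓑.metric.val x (𝓑.metric.leviCivita K x v) w +
        𝓑.metric.val x v (𝓑.metric.leviCivita K x w) = 0)
    (h11 : ∀ x ∈ U, VectorField.mlieBracket (𝓡 4) 𝓑.killing K x = 0)
    (h12 : ∀ p ∈ 𝓑.horizon, K p ≠ 0)
    (h13 : ∀ γ : ℝ → 𝓑.carrier, IsMIntegralCurve γ K → γ 0 ∈ 𝓑.horizon → ∀ t, γ t ∈ 𝓑.horizon)
    (h14 : ∀ x ∈ U ∩ 𝓑.doc, 𝓑.metric.val x (K x) (K x) < 0) :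
    ContMDiffOn (𝓡 4) ((𝓡 4).prod 𝓘(ℝ, E4)) ((⊤ : ℕ∞) : WithTop ℕ∞)
      (fun x ↦ (Bundle.TotalSpace.mk' E4 x ((c • K) x) : TangentBundle (𝓡 4) 𝓑.carrier)) U ∧
    (∀ x ∈ U, ∀ v w : TangentSpace (𝓡 4) x,
      𝓑.metric.val x (𝓑.metric.leviCivita (c • K) x v) w +
        𝓑.metric.val x v (𝓑.metric.leviCivita (c • K) x w) = 0) ∧
    (∀ x ∈ U, VectorField.mlieBracket (𝓡 4) 𝓑.killing (c • K) x = 0) ∧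
    (∀ p ∈ 𝓑.horizon, (c • K) p ≠ 0) ∧
    (∀ γ : ℝ → 𝓑.carrier, IsMIntegralCurve γ (c • K) → γ 0 ∈ 𝓑.horizon →
      ∀ t, γ t ∈ 𝓑.horizon) ∧
    (∀ x ∈ U ∩ 𝓑.doc, 𝓑.metric.val x ((c • K) x) ((c • K) x) < 0) := by
  refine ⟨ContMDiffOn.const_smul_section h9, killingOn_const_smul h6 h9 h10 c,
    bracketOn_const_smul h6 h9 h11 c, fun p hp ↦ by simpa [hc] using h12 p hp,
    integralCurves_stay_const_smul h13 hc, fun x hx ↦ ?_⟩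
  have h' := h14 x hx
  have hc2 : 0 < c * c := mul_self_pos.mpr hc
  simp only [Pi.smul_apply, map_smul, FunLike.coe_smul, smul_eq_mul]
  nlinarith

/-- **h9–h14 are INVARIANT under `K ↦ c • K`, `c ≠ 0`** (apply `collar_const_smul` with `c` and
with `c⁻¹`). [folklore] -/
theorem collar_const_smul_iff [𝓑.metric.HasLeviCivita] {U : Set 𝓑.carrier} (h6 : IsOpen U)
    (K : Π x : 𝓑.carrier, TangentSpace (𝓡 4) x) {c : ℝ} (hc : c ≠ 0) :
    (ContMDiffOn (𝓡 4) ((𝓡 4).prod 𝓘(ℝ, E4)) ((⊤ : ℕ∞) : WithTop ℕ∞)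
        (fun x ↦ (Bundle.TotalSpace.mk' E4 x (K x) : TangentBundle (𝓡 4) 𝓑.carrier)) U ∧
      (∀ x ∈ U, ∀ v w : TangentSpace (𝓡 4) x,
        𝓑.metric.val x (𝓑.metric.leviCivita K x v) w +
          𝓑.metric.val x v (𝓑.metric.leviCivita K x w) = 0) ∧
      (∀ x ∈ U, VectorField.mlieBracket (𝓡 4) 𝓑.killing K x = 0) ∧
      (∀ p ∈ 𝓑.horizon, K p ≠ 0) ∧
      (∀ γ : ℝ → 𝓑.carrier, IsMIntegralCurve γ K → γ 0 ∈ 𝓑.horizon → ∀ t, γ t ∈ 𝓑.horizon) ∧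
      (∀ x ∈ U ∩ 𝓑.doc, 𝓑.metric.val x (K x) (K x) < 0)) ↔
    (ContMDiffOn (𝓡 4) ((𝓡 4).prod 𝓘(ℝ, E4)) ((⊤ : ℕ∞) : WithTop ℕ∞)
        (fun x ↦ (Bundle.TotalSpace.mk' E4 x ((c • K) x) : TangentBundle (𝓡 4) 𝓑.carrier)) U ∧
      (∀ x ∈ U, ∀ v w : TangentSpace (𝓡 4) x,
        𝓑.metric.val x (𝓑.metric.leviCivita (c • K) x v) w +
          𝓑.metric.val x v (𝓑.metric.leviCivita (c • K) x w) = 0) ∧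
      (∀ x ∈ U, VectorField.mlieBracket (𝓡 4) 𝓑.killing (c • K) x = 0) ∧
      (∀ p ∈ 𝓑.horizon, (c • K) p ≠ 0) ∧
      (∀ γ : ℝ → 𝓑.carrier, IsMIntegralCurve γ (c • K) → γ 0 ∈ 𝓑.horizon →
        ∀ t, γ t ∈ 𝓑.horizon) ∧
      (∀ x ∈ U ∩ 𝓑.doc, 𝓑.metric.val x ((c • K) x) ((c • K) x) < 0)) := by
  constructor
  · rintro ⟨h9, h10, h11, h12, h13, h14⟩
    exact collar_const_smul h6 hc h9 h10 h11 h12 h13 h14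
  · rintro ⟨h9, h10, h11, h12, h13, h14⟩
    have hK : c⁻¹ • (c • K) = K := by rw [smul_smul, inv_mul_cancel₀ hc, one_smul]
    have h := collar_const_smul h6 (inv_ne_zero hc) h9 h10 h11 h12 h13 h14
    rwa [hK] at h

/-- **The conclusion for `K` implies the conclusion for `c • K`** (extend by `c • K'`; any `c`).
[folklore] -/
theorem conclusion_const_smul [𝓑.metric.HasLeviCivita]
    {K : Π x : 𝓑.carrier, TangentSpace (𝓡 4) x} (c : ℝ)
    (h : ∃ K' : Π x : 𝓑.carrier, TangentSpace (𝓡 4) x,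
      ContMDiffOn (𝓡 4) ((𝓡 4).prod 𝓘(ℝ, E4)) ((⊤ : ℕ∞) : WithTop ℕ∞)
        (fun x ↦ (Bundle.TotalSpace.mk' E4 x (K' x) : TangentBundle (𝓡 4) 𝓑.carrier)) 𝓑.doc ∧
      (∀ x ∈ 𝓑.doc, ∀ v w : TangentSpace (𝓡 4) x,
        𝓑.metric.val x (𝓑.metric.leviCivita K' x v) w +
          𝓑.metric.val x v (𝓑.metric.leviCivita K' x w) = 0) ∧
      (∀ x ∈ 𝓑.doc, VectorField.mlieBracket (𝓡 4) 𝓑.killing K' x = 0) ∧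
      ∃ U' : Set 𝓑.carrier, IsOpen U' ∧ 𝓑.horizon ⊆ U' ∧ ∀ x ∈ U' ∩ 𝓑.doc, K' x = K x) :
    ∃ K' : Π x : 𝓑.carrier, TangentSpace (𝓡 4) x,
      ContMDiffOn (𝓡 4) ((𝓡 4).prod 𝓘(ℝ, E4)) ((⊤ : ℕ∞) : WithTop ℕ∞)
        (fun x ↦ (Bundle.TotalSpace.mk' E4 x (K' x) : TangentBundle (𝓡 4) 𝓑.carrier)) 𝓑.doc ∧
      (∀ x ∈ 𝓑.doc, ∀ v w : TangentSpace (𝓡 4) x,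
        𝓑.metric.val x (𝓑.metric.leviCivita K' x v) w +
          𝓑.metric.val x v (𝓑.metric.leviCivita K' x w) = 0) ∧
      (∀ x ∈ 𝓑.doc, VectorField.mlieBracket (𝓡 4) 𝓑.killing K' x = 0) ∧
      ∃ U' : Set 𝓑.carrier, IsOpen U' ∧ 𝓑.horizon ⊆ U' ∧ ∀ x ∈ U' ∩ 𝓑.doc, K' x = (c • K) x := by
  obtain ⟨K', hsm, hkil, hbr, U', hU', hh, hdock⟩ := h
  exact ⟨c • K', ContMDiffOn.const_smul_section hsm,
    killingOn_const_smul (isOpen_doc_of_boundaryless 𝓑) hsm hkil c,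
    bracketOn_const_smul (isOpen_doc_of_boundaryless 𝓑) hsm hbr c, U', hU', hh,
    fun x hx ↦ by rw [Pi.smul_apply, Pi.smul_apply, hdock x hx]⟩

/-- **The conclusion is INVARIANT under `K ↦ c • K`, `c ≠ 0`.** [folklore] -/
theorem conclusion_const_smul_iff [𝓑.metric.HasLeviCivita]
    (K : Π x : 𝓑.carrier, TangentSpace (𝓡 4) x) {c : ℝ} (hc : c ≠ 0) :
    (∃ K' : Π x : 𝓑.carrier, TangentSpace (𝓡 4) x,
      ContMDiffOn (𝓡 4) ((𝓡 4).prod 𝓘(ℝ, E4)) ((⊤ : ℕ∞) : WithTop ℕ∞)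
        (fun x ↦ (Bundle.TotalSpace.mk' E4 x (K' x) : TangentBundle (𝓡 4) 𝓑.carrier)) 𝓑.doc ∧
      (∀ x ∈ 𝓑.doc, ∀ v w : TangentSpace (𝓡 4) x,
        𝓑.metric.val x (𝓑.metric.leviCivita K' x v) w +
          𝓑.metric.val x v (𝓑.metric.leviCivita K' x w) = 0) ∧
      (∀ x ∈ 𝓑.doc, VectorField.mlieBracket (𝓡 4) 𝓑.killing K' x = 0) ∧
      ∃ U' : Set 𝓑.carrier, IsOpen U' ∧ 𝓑.horizon ⊆ U' ∧ ∀ x ∈ U' ∩ 𝓑.doc, K' x = K x) ↔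
    (∃ K' : Π x : 𝓑.carrier, TangentSpace (𝓡 4) x,
      ContMDiffOn (𝓡 4) ((𝓡 4).prod 𝓘(ℝ, E4)) ((⊤ : ℕ∞) : WithTop ℕ∞)
        (fun x ↦ (Bundle.TotalSpace.mk' E4 x (K' x) : TangentBundle (𝓡 4) 𝓑.carrier)) 𝓑.doc ∧
      (∀ x ∈ 𝓑.doc, ∀ v w : TangentSpace (𝓡 4) x,
        𝓑.metric.val x (𝓑.metric.leviCivita K' x v) w +
          𝓑.metric.val x v (𝓑.metric.leviCivita K' x w) = 0) ∧
      (∀ x ∈ 𝓑.doc, VectorField.mlieBracket (𝓡 4) 𝓑.killing K' x = 0) ∧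
      ∃ U' : Set 𝓑.carrier, IsOpen U' ∧ 𝓑.horizon ⊆ U' ∧ ∀ x ∈ U' ∩ 𝓑.doc, K' x = (c • K) x) := by
  refine ⟨fun h ↦ conclusion_const_smul c h, fun h ↦ ?_⟩
  have hK : c⁻¹ • (c • K) = K := by rw [smul_smul, inv_mul_cancel₀ hc, one_smul]
  have h' := conclusion_const_smul c⁻¹ h
  rwa [hK] at h'

end Summit.FinalStateConjecture.FinalStateConjecture.Theorems.NonTrappingHawkingRigidity.Negative
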